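import Mathlib.Analysis.Calculus.ContDiff.Convolution
import Mathlib.Analysis.Calculus.BumpFunction.Normed
import Mathlib.Analysis.Calculus.BumpFunction.FiniteDimension
import Mathlib.Analysis.Calculus.IteratedDeriv.Lemmas
import Mathlib.MeasureTheory.Integral.IntegralEqImproper
import Mathlib.Analysis.Distribution.SchwartzSpace.Basic
import HarnessLib

/-!
# Bump functions adapted to a finite order, with explicit derivative growth (convolution powers)

Topic `Literature/Analysis/Distribution`. For every `n` there is a smooth bump `β_n ≥ 0` on `ℝ` of
mass one supported in `[−(n+1), n+1]` whose derivatives of order `j ≤ n` are bounded by `Aʲ` for an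
absolute constant `A` (`norm_iteratedDeriv_convPow_le`); rescaled to support `[−r, r]`
(`adaptedBump n r`), the derivatives of order `j ≤ n` are bounded by `((n+1)/r)^{j+1} Aʲ` — growth
**geometric in the order with ratio `≍ n/r`**, hence constants of factorial type `n^{O(n)}` when the
needed order is `≍ n`. This is the standard construction by convolution powers (Hörmander, *The
Analysis of Linear Partial Differential Operators I*, Thm. 1.3.5: "`|u⁽ᵏ⁾| ≤ Cᵏ/(a₁ ⋯ a_k)`",
with all `aⱼ` equal): `β_n = q ⋆ ⋯ ⋆ q` (`n + 1` factors) for a fixed smooth bump `q` of mass one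
supported in `[−1, 1]`; each derivative is put on a different factor, so that only the absolute
constants `sup |q| ≤ 1` and `A = ∫ |q'|` enter.

Such order-adapted test functions are what the linear growth condition E0' of Osterwalder–Schrader
II is paired with to obtain the temperedness estimate (4.5) with constants of factorial growth
(Comm. Math. Phys. 42 (1975), Ch. VI.1, where Gevrey-class functions from the
Carleman–Mandelbrojt theorem are used instead, (6.2)).

* `baseBump`, `baseFn` (`q`), `baseFn_le_one`, `baseDerivL1` (`A`);
* `convPow n` (`β_n`), smooth, compactly supported in `[−(n+1), n+1]`, nonnegative, mass one;
* `iteratedDeriv_convolution_right`, `deriv_convolution_left'` — derivatives of `q ⋆ g`;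
* `abs_convolution_le` — `|(f ⋆ g)(x)| ≤ ∫|f| · sup |g|`;
* `norm_iteratedDeriv_convPow_le` — `|β_n⁽ʲ⁾| ≤ Aʲ` for `j ≤ n`;
* `adaptedBump n r`, its support, mass, sign and `norm_iteratedDeriv_adaptedBump_le`.

## References

* L. Hörmander, *The Analysis of Linear Partial Differential Operators I*, 2nd ed., Thm. 1.3.5.
  [HormanderALPDO1]
* K. Osterwalder, R. Schrader, *Axioms for Euclidean Green's functions II*, Comm. Math. Phys. 42
  (1975) 281–305, Ch. VI.1 (6.2). [OsterwalderSchraderCMP1975]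

Everything here is folklore.
-/

noncomputable section

open MeasureTheory Set Filter Metric Function ContinuousLinearMap
open scoped Convolution ContDiff Topology

namespace Literature.Analysis.Distribution

/-! ### The base bump -/

/-- The base bump: Mathlib's smooth bump on `ℝ` with radii `1/2 < 1`. [folklore] -/
def baseBump : ContDiffBump (0 : ℝ) := ⟨1 / 2, 1, by norm_num, by norm_num⟩

/-- **The base function** `q`: the base bump normalised to mass one. [folklore] -/
def baseFn : ℝ → ℝ := baseBump.normed volume

/-- `q` is smooth. [folklore] -/
theorem contDiff_baseFn {n : ℕ∞} : ContDiff ℝ n baseFn := baseBump.contDiff_normed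

/-- `q ≥ 0`. [folklore] -/
theorem baseFn_nonneg (x : ℝ) : 0 ≤ baseFn x := baseBump.nonneg_normed x

/-- `∫ q = 1`. [folklore] -/
theorem integral_baseFn : ∫ x, baseFn x = 1 := baseBump.integral_normed

/-- `q` has compact support, `tsupport q = [−1, 1]`. [folklore] -/
theorem hasCompactSupport_baseFn : HasCompactSupport baseFn := baseBump.hasCompactSupport_normed

/-- `tsupport q = closedBall 0 1`. [folklore] -/
theorem tsupport_baseFn : tsupport baseFn = closedBall (0 : ℝ) 1 := baseBump.tsupport_normed_eq

/-- **`q ≤ 1`**: the mass of the unnormalised bump is at least the length `1` of `[−1/2, 1/2]`. [folklore] -/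
theorem baseFn_le_one (x : ℝ) : baseFn x ≤ 1 := by
  have h := baseBump.normed_le_div_measure_closedBall_rIn volume x
  have hm : (volume : Measure ℝ).real (closedBall (0 : ℝ) baseBump.rIn) = 1 := by
    rw [Measure.real, Real.volume_closedBall]
    norm_num [baseBump]
  rw [hm, div_one] at h
  exact h

/-- `|q x| ≤ 1`. [folklore] -/
theorem abs_baseFn_le_one (x : ℝ) : |baseFn x| ≤ 1 := by
  rw [abs_of_nonneg (baseFn_nonneg x)]; exact baseFn_le_one x

/-- `q` is integrable, locally integrable, continuous. [folklore] -/
theorem continuous_baseFn : Continuous baseFn := (contDiff_baseFn (n := 0)).continuous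

/-- `q` is integrable. [folklore] -/
theorem integrable_baseFn : Integrable baseFn := continuous_baseFn.integrable_of_hasCompactSupport hasCompactSupport_baseFn

/-- **The absolute constant** `A = ∫ |q'|`. [folklore] -/
def baseDerivL1 : ℝ := ∫ x, |deriv baseFn x|

/-- `0 ≤ A`. [folklore] -/
theorem baseDerivL1_nonneg : 0 ≤ baseDerivL1 := integral_nonneg fun _ => abs_nonneg _

/-- `q'` is continuous with compact support. [folklore] -/
theorem continuous_deriv_baseFn : Continuous (deriv baseFn) := (contDiff_baseFn (n := 1)).continuous_deriv le_rfl

/-- `q'` has compact support. [folklore] -/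
theorem hasCompactSupport_deriv_baseFn : HasCompactSupport (deriv baseFn) := hasCompactSupport_baseFn.deriv

/-- `q'` is integrable. [folklore] -/
theorem integrable_deriv_baseFn : Integrable (deriv baseFn) :=
  continuous_deriv_baseFn.integrable_of_hasCompactSupport hasCompactSupport_deriv_baseFn

/-- `|q'|` is integrable. [folklore] -/
theorem integrable_abs_deriv_baseFn : Integrable fun x => |deriv baseFn x| := integrable_deriv_baseFn.abs

/-! ### Convolution with the base function: bounds and derivatives -/

/-- **Pointwise Young inequality**: `|(f ⋆ g)(x)| ≤ (∫ |f|) · M` if `|g| ≤ M`, `f` integrable. [folklore] -/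
theorem abs_convolution_le {f g : ℝ → ℝ} (hf : Integrable f) {M : ℝ} (hg : ∀ x, |g x| ≤ M) (x : ℝ) :
    |(f ⋆[lsmul ℝ ℝ, volume] g) x| ≤ (∫ t, |f t|) * M := by
  rw [convolution_def]
  simp only [lsmul_apply, smul_eq_mul]
  have hM : 0 ≤ M := (abs_nonneg _).trans (hg 0)
  calc |∫ t, f t * g (x - t)| ≤ ∫ t, |f t * g (x - t)| := abs_integral_le_integral_abs
    _ ≤ ∫ t, |f t| * M := by
        refine integral_mono_of_nonneg (Eventually.of_forall fun t => abs_nonneg _) (hf.abs.mul_const M)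
          (Eventually.of_forall fun t => ?_)
        show |f t * g (x - t)| ≤ |f t| * M
        rw [abs_mul]
        exact mul_le_mul_of_nonneg_left (hg _) (abs_nonneg _)
    _ = (∫ t, |f t|) * M := integral_mul_const M _

/-- **Derivative of `f ⋆ g` on the smooth compactly supported right factor**: `(f ⋆ g)' = f ⋆ g'`. [folklore] -/
theorem deriv_convolution_right' {f g : ℝ → ℝ} (hf : LocallyIntegrable f) (hg : ContDiff ℝ 1 g) (hgs : HasCompactSupport g) :
    deriv (f ⋆[lsmul ℝ ℝ, volume] g) = f ⋆[lsmul ℝ ℝ, volume] deriv g :=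
  funext fun x => (hgs.hasDerivAt_convolution_right (lsmul ℝ ℝ) hf hg x).deriv

/-- **Derivative of `f ⋆ g` on the smooth compactly supported left factor**: `(f ⋆ g)' = f' ⋆ g`. [folklore] -/
theorem deriv_convolution_left' {f g : ℝ → ℝ} (hf : ContDiff ℝ 1 f) (hfs : HasCompactSupport f) (hg : LocallyIntegrable g) :
    deriv (f ⋆[lsmul ℝ ℝ, volume] g) = deriv f ⋆[lsmul ℝ ℝ, volume] g :=
  funext fun x => (hfs.hasDerivAt_convolution_left (lsmul ℝ ℝ) hf hg x).deriv

/-- Iterated derivatives of a compactly supported function have compact support. [folklore] -/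
theorem hasCompactSupport_iteratedDeriv {g : ℝ → ℝ} (hgs : HasCompactSupport g) (j : ℕ) :
    HasCompactSupport (iteratedDeriv j g) := by
  induction j with
  | zero => simpa using hgs
  | succ j ih => rw [iteratedDeriv_succ]; exact ih.deriv

/-- The topological support of an iterated derivative is in that of the function. [folklore] -/
theorem tsupport_iteratedDeriv_subset' {g : ℝ → ℝ} (j : ℕ) : tsupport (iteratedDeriv j g) ⊆ tsupport g := by
  induction j with
  | zero => simp
  | succ j ih => rw [iteratedDeriv_succ]; exact tsupport_deriv_subset.trans ih

/-- Iterated derivatives of a smooth function are smooth. [folklore] -/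
theorem contDiff_iteratedDeriv_of_contDiff_infty {g : ℝ → ℝ} (hg : ContDiff ℝ ∞ g) (j : ℕ) {n : ℕ∞} :
    ContDiff ℝ n (iteratedDeriv j g) := by
  rw [iteratedDeriv_eq_iterate]
  exact (hg.iterate_deriv j).of_le (mod_cast le_top)

/-- **All derivatives of `f ⋆ g` on the smooth compactly supported right factor**:
`(f ⋆ g)⁽ʲ⁾ = f ⋆ g⁽ʲ⁾`. [folklore] -/
theorem iteratedDeriv_convolution_right {f g : ℝ → ℝ} (hf : LocallyIntegrable f) (hg : ContDiff ℝ ∞ g) (hgs : HasCompactSupport g)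
    (j : ℕ) : iteratedDeriv j (f ⋆[lsmul ℝ ℝ, volume] g) = f ⋆[lsmul ℝ ℝ, volume] iteratedDeriv j g := by
  induction j with
  | zero => simp
  | succ j ih =>
    rw [iteratedDeriv_succ, ih, iteratedDeriv_succ]
    exact deriv_convolution_right' hf (contDiff_iteratedDeriv_of_contDiff_infty hg j) (hasCompactSupport_iteratedDeriv hgs j)

/-- `∫ |q| = 1`. [folklore] -/
theorem integral_abs_baseFn : ∫ x, |baseFn x| = 1 := by
  rw [show (fun x => |baseFn x|) = baseFn from funext fun x => abs_of_nonneg (baseFn_nonneg x), integral_baseFn]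

/-! ### Convolution powers -/

/-- **The convolution powers** `β_n = q ⋆ ⋯ ⋆ q` (`n + 1` factors). [cite: HormanderALPDO1, Thm 1.3.5] -/
def convPow : ℕ → ℝ → ℝ
  | 0 => baseFn
  | n + 1 => baseFn ⋆[lsmul ℝ ℝ, volume] convPow n

/-- `β₀ = q`. [folklore] -/
@[simp] theorem convPow_zero : convPow 0 = baseFn := rfl

/-- `β_{n+1} = q ⋆ β_n`. [folklore] -/
theorem convPow_succ (n : ℕ) : convPow (n + 1) = baseFn ⋆[lsmul ℝ ℝ, volume] convPow n := rfl

/-- `β_n` is smooth and compactly supported. [folklore] -/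
theorem contDiff_and_hasCompactSupport_convPow (n : ℕ) : ContDiff ℝ ∞ (convPow n) ∧ HasCompactSupport (convPow n) := by
  induction n with
  | zero => exact ⟨contDiff_baseFn, hasCompactSupport_baseFn⟩
  | succ n ih =>
    rw [convPow_succ]
    exact ⟨hasCompactSupport_baseFn.contDiff_convolution_left (lsmul ℝ ℝ) contDiff_baseFn
        ih.1.continuous.locallyIntegrable,
      hasCompactSupport_baseFn.convolution (lsmul ℝ ℝ) ih.2⟩

/-- `β_n` is smooth. [folklore] -/
theorem contDiff_convPow (n : ℕ) {m : ℕ∞} : ContDiff ℝ m (convPow n) :=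
  (contDiff_and_hasCompactSupport_convPow n).1.of_le (mod_cast le_top)

/-- `β_n` has compact support. [folklore] -/
theorem hasCompactSupport_convPow (n : ℕ) : HasCompactSupport (convPow n) := (contDiff_and_hasCompactSupport_convPow n).2

/-- `β_n` is continuous. [folklore] -/
theorem continuous_convPow (n : ℕ) : Continuous (convPow n) := (contDiff_convPow n (m := 0)).continuous

/-- `β_n` is integrable. [folklore] -/
theorem integrable_convPow (n : ℕ) : Integrable (convPow n) :=
  (continuous_convPow n).integrable_of_hasCompactSupport (hasCompactSupport_convPow n)

/-- `β_n ≥ 0`. [folklore] -/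
theorem convPow_nonneg (n : ℕ) (x : ℝ) : 0 ≤ convPow n x := by
  induction n generalizing x with
  | zero => exact baseFn_nonneg x
  | succ n ih =>
    rw [convPow_succ, convolution_def]
    exact integral_nonneg fun t => by simpa using mul_nonneg (baseFn_nonneg t) (ih (x - t))

/-- **`∫ β_n = 1`**. [folklore] -/
theorem integral_convPow (n : ℕ) : ∫ x, convPow n x = 1 := by
  induction n with
  | zero => exact integral_baseFn
  | succ n ih =>
    rw [convPow_succ, integral_convolution (lsmul ℝ ℝ) integrable_baseFn (integrable_convPow n), integral_baseFn, ih]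
    simp

/-- **`|β_n| ≤ 1`**. [folklore] -/
theorem abs_convPow_le_one (n : ℕ) (x : ℝ) : |convPow n x| ≤ 1 := by
  induction n generalizing x with
  | zero => exact abs_baseFn_le_one x
  | succ n ih =>
    rw [convPow_succ]
    have h := abs_convolution_le integrable_baseFn ih x
    rwa [integral_abs_baseFn, one_mul] at h

/-- **The support of `β_n`** is contained in `[−(n+1), n+1]`. [folklore] -/
theorem tsupport_convPow_subset (n : ℕ) : tsupport (convPow n) ⊆ closedBall (0 : ℝ) (n + 1) := by
  induction n with
  | zero => rw [convPow_zero, tsupport_baseFn]; norm_num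
  | succ n ih =>
    rw [convPow_succ]
    refine closure_minimal ?_ isClosed_closedBall
    refine (support_convolution_subset (L := lsmul ℝ ℝ) (μ := volume)).trans ?_
    intro x hx
    obtain ⟨a, ha, b, hb, rfl⟩ := hx
    have ha' : a ∈ closedBall (0 : ℝ) 1 := by rw [← tsupport_baseFn]; exact subset_tsupport _ ha
    have hb' : b ∈ closedBall (0 : ℝ) (n + 1) := ih (subset_tsupport _ hb)
    rw [mem_closedBall, dist_zero_right, Real.norm_eq_abs] at ha' hb' ⊢
    push_cast
    calc |a + b| ≤ |a| + |b| := abs_add_le _ _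
      _ ≤ 1 + (n + 1) := add_le_add ha' hb'
      _ = n + 1 + 1 := by ring

/-- **The derivatives of `β_n` of order `j ≤ n` are bounded by `Aʲ`** (each derivative on a different
factor: `β_n⁽ʲ⁾ = q ⋆ β_{n-1}⁽ʲ⁾` for `j ≤ n − 1`, and `β_n⁽ⁿ⁾ = q' ⋆ β_{n-1}⁽ⁿ⁻¹⁾`). [cite: HormanderALPDO1, Thm 1.3.5] -/
theorem abs_iteratedDeriv_convPow_le (n : ℕ) : ∀ j ≤ n, ∀ x, |iteratedDeriv j (convPow n) x| ≤ baseDerivL1 ^ j := by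
  induction n with
  | zero =>
    intro j hj x
    rw [Nat.le_zero.1 hj, iteratedDeriv_zero, pow_zero, convPow_zero]
    exact abs_baseFn_le_one x
  | succ n ih =>
    intro j hj x
    rcases Nat.lt_or_eq_of_le hj with hlt | heq
    · -- `j ≤ n`: the derivatives fall on the right factor
      have hj' : j ≤ n := Nat.lt_succ_iff.1 hlt
      rw [convPow_succ, iteratedDeriv_convolution_right continuous_baseFn.locallyIntegrable
        (contDiff_convPow n) (hasCompactSupport_convPow n) j]
      have h := abs_convolution_le integrable_baseFn (ih j hj') x
      rwa [integral_abs_baseFn, one_mul] at h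
    · -- `j = n + 1`: one more derivative, on the left factor
      subst heq
      rw [iteratedDeriv_succ, convPow_succ, iteratedDeriv_convolution_right continuous_baseFn.locallyIntegrable
        (contDiff_convPow n) (hasCompactSupport_convPow n) n,
        deriv_convolution_left' contDiff_baseFn hasCompactSupport_baseFn
          ((contDiff_iteratedDeriv_of_contDiff_infty (contDiff_convPow n) n (n := 0)).continuous.locallyIntegrable)]
      have h := abs_convolution_le integrable_deriv_baseFn (ih n le_rfl) x
      rw [pow_succ, mul_comm]
      exact h

/-! ### The adapted bumps of support radius `r` -/

/-- **The adapted bump of order `n` and radius `r`**: `x ↦ ((n+1)/r) β_n((n+1) x / r)`. [cite: HormanderALPDO1, Thm 1.3.5] -/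
def adaptedBump (n : ℕ) (r : ℝ) (x : ℝ) : ℝ := (n + 1) / r * convPow n ((n + 1) / r * x)

/-- The scaling factor `(n+1)/r` is positive. [folklore] -/
theorem adaptedBump_ratio_pos (n : ℕ) {r : ℝ} (hr : 0 < r) : 0 < ((n : ℝ) + 1) / r := by positivity

/-- The adapted bump is smooth. [folklore] -/
theorem contDiff_adaptedBump (n : ℕ) (r : ℝ) {m : ℕ∞} : ContDiff ℝ m (adaptedBump n r) :=
  contDiff_const.mul ((contDiff_convPow n).comp (contDiff_const.mul contDiff_id))

/-- The adapted bump is nonnegative (`r > 0`). [folklore] -/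
theorem adaptedBump_nonneg (n : ℕ) {r : ℝ} (hr : 0 < r) (x : ℝ) : 0 ≤ adaptedBump n r x :=
  mul_nonneg (adaptedBump_ratio_pos n hr).le (convPow_nonneg n _)

/-- **The support of the adapted bump is in `[−r, r]`.** [folklore] -/
theorem tsupport_adaptedBump_subset (n : ℕ) {r : ℝ} (hr : 0 < r) : tsupport (adaptedBump n r) ⊆ closedBall (0 : ℝ) r := by
  refine closure_minimal (fun x hx => ?_) isClosed_closedBall
  rw [mem_support] at hx
  have hx' : convPow n (((n : ℝ) + 1) / r * x) ≠ 0 := fun h => hx (by rw [adaptedBump, h, mul_zero])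
  have hmem := tsupport_convPow_subset n (subset_tsupport _ (mem_support.2 hx'))
  rw [mem_closedBall, dist_zero_right, Real.norm_eq_abs] at hmem ⊢
  rw [abs_mul, abs_of_pos (adaptedBump_ratio_pos n hr)] at hmem
  rw [div_mul_eq_mul_div, div_le_iff₀ hr] at hmem
  have hn : (0 : ℝ) < n + 1 := by positivity
  nlinarith

/-- The adapted bump has compact support. [folklore] -/
theorem hasCompactSupport_adaptedBump (n : ℕ) {r : ℝ} (hr : 0 < r) : HasCompactSupport (adaptedBump n r) :=
  HasCompactSupport.of_support_subset_isCompact (isCompact_closedBall (0 : ℝ) r)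
    ((subset_tsupport _).trans (tsupport_adaptedBump_subset n hr))

/-- **The adapted bump has mass one.** [folklore] -/
theorem integral_adaptedBump (n : ℕ) {r : ℝ} (hr : 0 < r) : ∫ x, adaptedBump n r x = 1 := by
  unfold adaptedBump
  rw [integral_const_mul, Measure.integral_comp_mul_left (fun y => convPow n y) (((n : ℝ) + 1) / r), integral_convPow,
    smul_eq_mul, mul_one, abs_of_pos (inv_pos.2 (adaptedBump_ratio_pos n hr)),
    mul_inv_cancel₀ (adaptedBump_ratio_pos n hr).ne']

/-- **The derivatives of the adapted bump of order `j ≤ n`**: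
`|(adaptedBump n r)⁽ʲ⁾(x)| ≤ ((n+1)/r)^{j+1} Aʲ`. [cite: HormanderALPDO1, Thm 1.3.5] -/
theorem abs_iteratedDeriv_adaptedBump_le (n : ℕ) {r : ℝ} (hr : 0 < r) {j : ℕ} (hj : j ≤ n) (x : ℝ) :
    |iteratedDeriv j (adaptedBump n r) x| ≤ (((n : ℝ) + 1) / r) ^ (j + 1) * baseDerivL1 ^ j := by
  set c : ℝ := ((n : ℝ) + 1) / r with hc
  have hcpos : 0 < c := adaptedBump_ratio_pos n hr
  have h1 : iteratedDeriv j (adaptedBump n r) x = c * iteratedDeriv j (fun y => convPow n (c * y)) x := by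
    unfold adaptedBump
    rw [← hc]
    exact iteratedDeriv_const_mul c (((contDiff_convPow n).comp (contDiff_const.mul contDiff_id)).contDiffAt)
  have h2 : iteratedDeriv j (fun y => convPow n (c * y)) x = c ^ j * iteratedDeriv j (convPow n) (c * x) := by
    rw [iteratedDeriv_comp_const_mul (contDiff_convPow n) c]
  rw [h1, h2, abs_mul, abs_mul, abs_of_pos hcpos, abs_of_pos (pow_pos hcpos j), pow_succ]
  have h3 := abs_iteratedDeriv_convPow_le n j hj (c * x)
  calc c * (c ^ j * |iteratedDeriv j (convPow n) (c * x)|) = c ^ j * c * |iteratedDeriv j (convPow n) (c * x)| := by ring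
    _ ≤ c ^ j * c * baseDerivL1 ^ j := mul_le_mul_of_nonneg_left h3 (by positivity)

/-! ### The adapted bumps as Schwartz functions -/

/-- **The adapted bump as a Schwartz function** (`r > 0`). [folklore] -/
def adaptedBumpS (n : ℕ) {r : ℝ} (hr : 0 < r) : SchwartzMap ℝ ℝ :=
  (hasCompactSupport_adaptedBump n hr).toSchwartzMap (contDiff_adaptedBump n r)

/-- Values of the Schwartz adapted bump. [folklore] -/
@[simp] theorem adaptedBumpS_apply (n : ℕ) {r : ℝ} (hr : 0 < r) (x : ℝ) : adaptedBumpS n hr x = adaptedBump n r x := rfl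

/-- **Schwartz seminorms of the adapted bump**: for `m ≤ n`,
`p_{k,m}(adaptedBump n r) ≤ rᵏ ((n+1)/r)^{m+1} Aᵐ`. [folklore] -/
theorem seminorm_adaptedBumpS_le (n : ℕ) {r : ℝ} (hr : 0 < r) (k : ℕ) {m : ℕ} (hm : m ≤ n) :
    SchwartzMap.seminorm ℝ k m (adaptedBumpS n hr) ≤ r ^ k * ((((n : ℝ) + 1) / r) ^ (m + 1) * baseDerivL1 ^ m) := by
  refine SchwartzMap.seminorm_le_bound ℝ k m _ (by have := baseDerivL1_nonneg; positivity) fun x => ?_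
  rw [norm_iteratedFDeriv_eq_norm_iteratedDeriv, Real.norm_eq_abs, Real.norm_eq_abs]
  change |x| ^ k * |iteratedDeriv m (adaptedBump n r) x| ≤ _
  by_cases hx : x ∈ tsupport (adaptedBump n r)
  · have hxr : |x| ≤ r := by
      have h := tsupport_adaptedBump_subset n hr hx
      rwa [mem_closedBall, dist_zero_right, Real.norm_eq_abs] at h
    exact mul_le_mul (pow_le_pow_left₀ (abs_nonneg _) hxr k) (abs_iteratedDeriv_adaptedBump_le n hr hm x)
      (abs_nonneg _) (by positivity)
  · have h0 : iteratedDeriv m (adaptedBump n r) x = 0 :=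
      image_eq_zero_of_notMem_tsupport fun h => hx (tsupport_iteratedDeriv_subset' m h)
    rw [h0, abs_zero, mul_zero]
    have := baseDerivL1_nonneg
    positivity

end Literature.Analysis.Distribution
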